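import Literature.AlgebraicGeometry.Motives.MixedHodgeExtensionHomFunctor
import Literature.AlgebraicGeometry.Motives.MixedHodgeExtensionTensorHomAdjunctionNaturality
import Literature.AlgebraicGeometry.Motives.MixedHodgeExtensionTensorTate
import Literature.AlgebraicGeometry.Motives.MixedHodgeExtensionDualNonSeparated
import HarnessLib

/-!
# The classes of `Hom(C, E)` and `Hom(E, C)`: `Hom(C, E) ≅ C^∨ ⊗ E`, `Hom(E, C) ≅ E^∨ ⊗ C`, `Hom(E, ℚ(0)) ≅ E^∨`

Deligne, *Théorie de Hodge II*, 1.1.12: for bifiltered objects the internal `Hom` is the tensor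
product with the dual, `Hom(H₁, H₂) ≅ H₁^∨ ⊗ H₂` (Cattani–El Zein–Griffiths–Lê §3.2.2.7 (1): the tree's
`hom H₁ H₂` IS `H₁^∨ ⊗ H₂` transported along `V^∨ ⊗ V' ≅ Hom(V, V')`, with the isomorphisms of MHS
`tensorToHom`, `homToTensor`). Carlson, *Extensions of mixed Hodge structures* (1980), §2(c)
Remark (3): the dual extension `0 → Â → Ĥ → B̂ → 0`, `^ = Hom(−, ℚ(0))`, has class `ψ̂ = -ψᵗ`
(the tree's `Extension.dual`, `clsW_dual`). Mac Lane, *Homology* III Prop. 1.8: along a morphism of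
extensions `(β, φ, α) : E → E'` one has `β_* E ≡ α^* E'`.

For an extension `E : 0 → B → E → A → 0` of mixed Hodge structures and a mixed Hodge structure `C`
(finite-dimensional carriers) this file proves:

* §0 naturality of `H₁^∨ ⊗ H₂ ≅ Hom(H₁, H₂)`: `Hom(f, g) ∘ tensorToHom = tensorToHom ∘ (ᵗf ⊗ g)`
  (immediate from the tree's DEFINITION `Hom.homMap f g = tensorToHom ∘ (ᵗf ⊗ g) ∘ homToTensor`; the
  companion `homToTensor ∘ Hom(f, g) = (ᵗf ⊗ g) ∘ homToTensor` is the tree's `homToTensor_comp_homMap`);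
* §1 the isomorphisms of extensions **`C^∨ ⊗ E → Hom(C, E)`** and `Hom(C, E) → C^∨ ⊗ E`
  (`Extension.lTensorDualToHomLeft`, `homLeftToLTensorDual`), hence
  `(≅)_* (C^∨ ⊗ E) ≡ (≅)^* Hom(C, E)`, **`Hom(C, E)` splits iff `C^∨ ⊗ E` splits**, and the class
  formula **`[Hom(C, E)]_W = JHomW.homLeft C [E]_W`** with
  `JHomW.homLeft C = (≅)^* ∘ (≅)_* ∘ (1_{C^∨} ⊗ ·)`;
* §2 the isomorphisms **`E^∨ ⊗ C → Hom(E, C)`** and back (`dualRTensorToHomRight`,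
  `homRightToDualRTensor`), `Hom(E, C)` splits iff `E^∨ ⊗ C` splits, and
  **`[Hom(E, C)]_W = JHomW.homRight C [E]_W`**, `JHomW.homRight C = -((≅)^* ∘ (≅)_* ∘ (· ⊗ 1_C) ∘ ᵗ)`;
* §3 on congruence classes: **`Ext.homLeftMap C x = (≅)^* (≅)_* (C^∨ ⊗ x)`**,
  **`Ext.homRightMap C x = (≅)^* (≅)_* (x^∨ ⊗ C)`**, so `Hom(C, −)` and `Hom(−, C)` on `Ext` are
  ADDITIVE (`homLeftMap_addW/_negW`, `homRightMap_addW/_negW`), with `extEquivJHomW ∘ homLeftMap C =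
  JHomW.homLeft C ∘ extEquivJHomW` (same on the right) and the vanishing criteria;
* §4 **Carlson's dual extension is `Hom(E, ℚ(0))`**: the isomorphism of MHS `Hom(X, ℚ(0)) ≅ X^∨`
  (`homUnitToDual`, underlying map the identity of `V →ₗ ℚ`), the isomorphism of extensions
  `Hom(E, ℚ(0)) → E^∨` over it, and on `Ext`:
  **`(≅)_* Hom(x, ℚ(0)) = (≅)^* x^∨`**, `x^∨ = (≅)^* (≅)_* Hom(x, ℚ(0))`; `Hom(E, ℚ(0))` splits iff
  `E` splits.

All statements proved; no named facts.

## References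

* [DeligneHodgeII1971] P. Deligne, Théorie de Hodge II, 1.1.12, Thm. 2.3.5.
* [CattaniElZeinGriffithsLe2014] E. Cattani, F. El Zein, P. A. Griffiths, Lê D. T. (eds.), Hodge
  Theory (2014), §3.2.2.7.
* [Carlson1980] J. A. Carlson, Extensions of mixed Hodge structures (1980), §2(b) Prop. 1, §2(c)
  Remark (3).
* [MacLane1963Homology] S. Mac Lane, Homology (1963), Ch. III §1 Lemmas 1.2, 1.4, Prop. 1.8, Thm. 2.1.
* [Jannsen1990MixedMotives] U. Jannsen, Mixed Motives and Algebraic K-Theory, LNM 1400 (1990), §9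
  Remark 9.3 a).
* [BrylinskiZucker1998] J.-L. Brylinski, S. Zucker, An overview of recent advances in Hodge theory,
  Prop. 5.22.
-/

noncomputable section

open scoped TensorProduct

namespace Literature.AlgebraicGeometry.Motives

namespace MixedHodgeStructure

open HodgeStructure (tate)

/-! ### §0 Naturality of `H₁^∨ ⊗ H₂ ≅ Hom(H₁, H₂)` and iso-cancellation on classes -/

section Naturality

variable {V : Type*} [AddCommGroup V] [Module ℚ V] [FiniteDimensional ℚ V]
variable {V' : Type*} [AddCommGroup V'] [Module ℚ V'] [FiniteDimensional ℚ V']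
variable {U : Type*} [AddCommGroup U] [Module ℚ U] [FiniteDimensional ℚ U]
variable {U' : Type*} [AddCommGroup U'] [Module ℚ U'] [FiniteDimensional ℚ U']
variable {H₁ : MixedHodgeStructure V} {H₁' : MixedHodgeStructure U} {H₂ : MixedHodgeStructure V'}
  {H₂' : MixedHodgeStructure U'}

/-- **`Hom(f, g) ∘ (H₁^∨ ⊗ H₂ ≅ Hom(H₁, H₂)) = (H₁'^∨ ⊗ H₂' ≅ Hom(H₁', H₂')) ∘ (ᵗf ⊗ g)`**: the
identification `Hom = dual ⊗` is natural (the tree defines `Hom(f, g)` as the conjugate of `ᵗf ⊗ g`).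
[cite: DeligneHodgeII1971, 1.1.12] [cite: CattaniElZeinGriffithsLe2014, §3.2.2.7] -/
theorem Hom.homMap_comp_tensorToHom (f : Hom H₁' H₁) (g : Hom H₂ H₂') :
    (Hom.homMap f g).comp (tensorToHom H₁ H₂) = (tensorToHom H₁' H₂').comp (f.transpose.tensorMap g) :=
  Hom.ext (by
    simp only [Hom.homMap, Hom.comp_toLinearMap, LinearMap.comp_assoc]
    rw [← Hom.comp_toLinearMap (homToTensor H₁ H₂), homToTensor_comp_tensorToHom, Hom.id_toLinearMap,
      LinearMap.comp_id])

/-- `Hom(C, g) ∘ (≅) = (≅) ∘ (1_{C^∨} ⊗ g)`. [cite: DeligneHodgeII1971, 1.1.12] -/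
theorem Hom.homMap_id_comp_tensorToHom (C : MixedHodgeStructure V) (g : Hom H₂ H₂') :
    (Hom.homMap (Hom.id C) g).comp (tensorToHom C H₂) =
      (tensorToHom C H₂').comp ((Hom.id C.dual).tensorMap g) := by
  rw [Hom.homMap_comp_tensorToHom, Hom.transpose_id]

end Naturality

section Cancel

variable {VA : Type*} [AddCommGroup VA] [Module ℚ VA]
variable {VB : Type*} [AddCommGroup VB] [Module ℚ VB]
variable {VA' : Type*} [AddCommGroup VA'] [Module ℚ VA']
variable {VB' : Type*} [AddCommGroup VB'] [Module ℚ VB']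
variable {A : MixedHodgeStructure VA} {B : MixedHodgeStructure VB}
variable {A' : MixedHodgeStructure VA'} {B' : MixedHodgeStructure VB'}

/-- `f'^* f^* = id` on `J⁰W₀Hom` when `f ∘ f' = id` (inverse isomorphisms). [cite: Carlson1980, §2(b) Prop. 1] -/
theorem JHomW.precomp_precomp_of_comp_eq_id (f : Hom A' A) (f' : Hom A A') (h : f.comp f' = Hom.id A)
    (c : JHomW A B) : JHomW.precomp B f' (JHomW.precomp B f c) = c := by
  rw [← LinearMap.comp_apply, ← JHomW.precomp_comp, h, JHomW.precomp_id, LinearMap.id_apply]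

/-- `g'_* g_* = id` on `J⁰W₀Hom` when `g' ∘ g = id`. [cite: Carlson1980, §2(b) Prop. 1] -/
theorem JHomW.postcomp_postcomp_of_comp_eq_id (g : Hom B B') (g' : Hom B' B) (h : g'.comp g = Hom.id B)
    (c : JHomW A B) : JHomW.postcomp A g' (JHomW.postcomp A g c) = c := by
  rw [← LinearMap.comp_apply, ← JHomW.postcomp_comp, h, JHomW.postcomp_id, LinearMap.id_apply]

/-- `f'^* f^* = id` on `Ext` when `f ∘ f' = id`. [cite: MacLane1963Homology, Ch. III (1.2)] -/
theorem Ext.pullbackMapW_pullbackMapW_of_comp_eq_id (f : Hom A' A) (f' : Hom A A') (h : f.comp f' = Hom.id A)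
    (x : Ext A B) : Ext.pullbackMapW f' (Ext.pullbackMapW f x) = x := by
  rw [← Ext.pullbackMapW_comp, h, Ext.pullbackMapW_id]

/-- `g'_* g_* = id` on `Ext` when `g' ∘ g = id`. [cite: MacLane1963Homology, Ch. III (1.4')] -/
theorem Ext.pushoutMapW_pushoutMapW_of_comp_eq_id (g : Hom B B') (g' : Hom B' B) (h : g'.comp g = Hom.id B)
    (x : Ext A B) : Ext.pushoutMapW g' (Ext.pushoutMapW g x) = x := by
  rw [← Ext.pushoutMapW_comp, h, Ext.pushoutMapW_id]

end Cancel

variable {VA : Type*} [AddCommGroup VA] [Module ℚ VA] [FiniteDimensional ℚ VA]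
variable {VB : Type*} [AddCommGroup VB] [Module ℚ VB] [FiniteDimensional ℚ VB]
variable {VC : Type*} [AddCommGroup VC] [Module ℚ VC] [FiniteDimensional ℚ VC]

/-! ### §1 `Hom(C, E) ≅ C^∨ ⊗ E` as extensions, and the class of `Hom(C, E)` -/

section HomLeft

variable {VE : Type*} [AddCommGroup VE] [Module ℚ VE] [FiniteDimensional ℚ VE]
variable {A : MixedHodgeStructure VA} {B : MixedHodgeStructure VB}

namespace Extension

variable (E : Extension A B VE) (C : MixedHodgeStructure VC)

/-- **The isomorphism of extensions `C^∨ ⊗ E → Hom(C, E)`** over `C^∨ ⊗ B ≅ Hom(C, B)` and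
`C^∨ ⊗ A ≅ Hom(C, A)` (all three components `tensorToHom`; the squares commute by naturality of
`Hom = dual ⊗`). [cite: DeligneHodgeII1971, 1.1.12] [cite: CattaniElZeinGriffithsLe2014, §3.2.2.7] -/
def lTensorDualToHomLeft : Morphism (E.lTensor C.dual) (E.homLeft C) where
  left := tensorToHom C B
  mid := tensorToHom C E.mhs
  right := tensorToHom C A
  mid_inc := by
    change (tensorToHom C E.mhs).toLinearMap ∘ₗ ((Hom.id C.dual).tensorMap E.inc).toLinearMap =
      (Hom.homMap (Hom.id C) E.inc).toLinearMap ∘ₗ (tensorToHom C B).toLinearMap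
    rw [← Hom.comp_toLinearMap, ← Hom.comp_toLinearMap, Hom.homMap_id_comp_tensorToHom]
  proj_mid := by
    change (Hom.homMap (Hom.id C) E.proj).toLinearMap ∘ₗ (tensorToHom C E.mhs).toLinearMap =
      (tensorToHom C A).toLinearMap ∘ₗ ((Hom.id C.dual).tensorMap E.proj).toLinearMap
    rw [← Hom.comp_toLinearMap, ← Hom.comp_toLinearMap, Hom.homMap_id_comp_tensorToHom]

/-- Components of `C^∨ ⊗ E → Hom(C, E)` (by `rfl`). [cite: CattaniElZeinGriffithsLe2014, §3.2.2.7] -/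
@[simp]
theorem lTensorDualToHomLeft_left : (E.lTensorDualToHomLeft C).left = tensorToHom C B := rfl

/-- Components of `C^∨ ⊗ E → Hom(C, E)` (by `rfl`). [cite: CattaniElZeinGriffithsLe2014, §3.2.2.7] -/
@[simp]
theorem lTensorDualToHomLeft_mid : (E.lTensorDualToHomLeft C).mid = tensorToHom C E.mhs := rfl

/-- Components of `C^∨ ⊗ E → Hom(C, E)` (by `rfl`). [cite: CattaniElZeinGriffithsLe2014, §3.2.2.7] -/
@[simp]
theorem lTensorDualToHomLeft_right : (E.lTensorDualToHomLeft C).right = tensorToHom C A := rfl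

/-- **The inverse isomorphism of extensions `Hom(C, E) → C^∨ ⊗ E`** (components `homToTensor`).
[cite: DeligneHodgeII1971, 1.1.12] [cite: CattaniElZeinGriffithsLe2014, §3.2.2.7] -/
def homLeftToLTensorDual : Morphism (E.homLeft C) (E.lTensor C.dual) where
  left := homToTensor C B
  mid := homToTensor C E.mhs
  right := homToTensor C A
  mid_inc := by
    change (homToTensor C E.mhs).toLinearMap ∘ₗ (Hom.homMap (Hom.id C) E.inc).toLinearMap =
      ((Hom.id C.dual).tensorMap E.inc).toLinearMap ∘ₗ (homToTensor C B).toLinearMap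
    rw [← Hom.comp_toLinearMap, ← Hom.comp_toLinearMap, homToTensor_comp_homMap_id]
  proj_mid := by
    change ((Hom.id C.dual).tensorMap E.proj).toLinearMap ∘ₗ (homToTensor C E.mhs).toLinearMap =
      (homToTensor C A).toLinearMap ∘ₗ (Hom.homMap (Hom.id C) E.proj).toLinearMap
    rw [← Hom.comp_toLinearMap, ← Hom.comp_toLinearMap, homToTensor_comp_homMap_id]

/-- Components of `Hom(C, E) → C^∨ ⊗ E` (by `rfl`). [cite: CattaniElZeinGriffithsLe2014, §3.2.2.7] -/
@[simp]
theorem homLeftToLTensorDual_left : (E.homLeftToLTensorDual C).left = homToTensor C B := rfl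

/-- Components of `Hom(C, E) → C^∨ ⊗ E` (by `rfl`). [cite: CattaniElZeinGriffithsLe2014, §3.2.2.7] -/
@[simp]
theorem homLeftToLTensorDual_mid : (E.homLeftToLTensorDual C).mid = homToTensor C E.mhs := rfl

/-- Components of `Hom(C, E) → C^∨ ⊗ E` (by `rfl`). [cite: CattaniElZeinGriffithsLe2014, §3.2.2.7] -/
@[simp]
theorem homLeftToLTensorDual_right : (E.homLeftToLTensorDual C).right = homToTensor C A := rfl

/-- **`(C^∨ ⊗ B ≅ Hom(C, B))_* (C^∨ ⊗ E) ≡ (C^∨ ⊗ A ≅ Hom(C, A))^* Hom(C, E)`** (Mac Lane III Prop. 1.8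
along `C^∨ ⊗ E → Hom(C, E)`). [cite: MacLane1963Homology, Ch. III Prop. 1.8] -/
theorem nonempty_congruence_lTensor_dual_pushout_homLeft_pullback :
    Nonempty (Congruence ((E.lTensor C.dual).pushout (tensorToHom C B))
      ((E.homLeft C).pullback (tensorToHom C A))) :=
  nonempty_congruence_pushout_pullback_of_morphism (E.lTensorDualToHomLeft C)

/-- Conversely `(Hom(C, B) ≅ C^∨ ⊗ B)_* Hom(C, E) ≡ (Hom(C, A) ≅ C^∨ ⊗ A)^* (C^∨ ⊗ E)`.
[cite: MacLane1963Homology, Ch. III Prop. 1.8] -/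
theorem nonempty_congruence_homLeft_pushout_lTensor_dual_pullback :
    Nonempty (Congruence ((E.homLeft C).pushout (homToTensor C B))
      ((E.lTensor C.dual).pullback (homToTensor C A))) :=
  nonempty_congruence_pushout_pullback_of_morphism (E.homLeftToLTensorDual C)

/-- In the complete invariant: `(≅)_* [C^∨ ⊗ E]_W = (≅)^* [Hom(C, E)]_W`. [cite: MacLane1963Homology, Ch. III Prop. 1.8] -/
theorem postcomp_clsW_lTensor_dual_eq_precomp_clsW_homLeft :
    JHomW.postcomp (tensor C.dual A) (tensorToHom C B) (E.lTensor C.dual).clsW =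
      JHomW.precomp (hom C B) (tensorToHom C A) (E.homLeft C).clsW :=
  (E.lTensorDualToHomLeft C).postcomp_clsW_eq_precomp_clsW

/-- **`[Hom(C, E)]_W = (Hom(C, A) ≅ C^∨ ⊗ A)^* (C^∨ ⊗ B ≅ Hom(C, B))_* [C^∨ ⊗ E]_W`.**
[cite: MacLane1963Homology, Ch. III Prop. 1.8] [cite: DeligneHodgeII1971, 1.1.12] -/
theorem clsW_homLeft_eq_clsW_lTensor_dual :
    (E.homLeft C).clsW =
      JHomW.precomp (hom C B) (homToTensor C A)
        (JHomW.postcomp (tensor C.dual A) (tensorToHom C B) (E.lTensor C.dual).clsW) := by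
  rw [postcomp_clsW_lTensor_dual_eq_precomp_clsW_homLeft,
    JHomW.precomp_precomp_of_comp_eq_id _ _ (tensorToHom_comp_homToTensor C A)]

/-- Conversely `[C^∨ ⊗ E]_W = (≅)^* (≅)_* [Hom(C, E)]_W`. [cite: MacLane1963Homology, Ch. III Prop. 1.8] -/
theorem clsW_lTensor_dual_eq_clsW_homLeft :
    (E.lTensor C.dual).clsW =
      JHomW.precomp (tensor C.dual B) (tensorToHom C A)
        (JHomW.postcomp (hom C A) (homToTensor C B) (E.homLeft C).clsW) := by
  have h := (E.homLeftToLTensorDual C).postcomp_clsW_eq_precomp_clsW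
  rw [homLeftToLTensorDual_left, homLeftToLTensorDual_right] at h
  rw [h, JHomW.precomp_precomp_of_comp_eq_id _ _ (homToTensor_comp_tensorToHom C A)]

/-- **`Hom(C, E)` splits iff `C^∨ ⊗ E` splits** (isomorphic extensions up to transport).
[cite: MacLane1963Homology, Ch. III Prop. 1.8] -/
theorem isSplit_homLeft_iff : (E.homLeft C).IsSplit ↔ (E.lTensor C.dual).IsSplit := by
  rw [isSplit_iff_clsW_eq_zero, isSplit_iff_clsW_eq_zero]
  constructor
  · intro h
    rw [clsW_lTensor_dual_eq_clsW_homLeft, h, map_zero, map_zero]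
  · intro h
    rw [clsW_homLeft_eq_clsW_lTensor_dual, h, map_zero, map_zero]

/-- `Hom(C, E)` splits iff `E ⊗ C^∨` splits. [cite: MacLane1963Homology, Ch. III Prop. 1.8] -/
theorem isSplit_homLeft_iff_isSplit_rTensor_dual : (E.homLeft C).IsSplit ↔ (E.rTensor C.dual).IsSplit := by
  rw [isSplit_homLeft_iff, isSplit_lTensor_iff_isSplit_rTensor]

end Extension

variable (C : MixedHodgeStructure VC)

/-- **`Hom(C, ·) : J⁰W₀Hom(A, B) → J⁰W₀Hom(Hom(C, A), Hom(C, B))`**, the transport of `1_{C^∨} ⊗ ·`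
along `Hom = dual ⊗`: `(Hom(C, A) ≅ C^∨ ⊗ A)^* ∘ (C^∨ ⊗ B ≅ Hom(C, B))_* ∘ (1_{C^∨} ⊗ ·)`.
[cite: DeligneHodgeII1971, 1.1.12] [cite: Jannsen1990MixedMotives, §9 Remark 9.3 a)] -/
def JHomW.homLeft : JHomW A B →ₗ[ℚ] JHomW (hom C A) (hom C B) :=
  JHomW.precomp (hom C B) (homToTensor C A) ∘ₗ JHomW.postcomp (tensor C.dual A) (tensorToHom C B) ∘ₗ
    JHomW.lTensor C.dual

/-- Unfolding `JHomW.homLeft` (by `rfl`). [cite: DeligneHodgeII1971, 1.1.12] -/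
theorem JHomW.homLeft_apply (c : JHomW A B) :
    JHomW.homLeft C c =
      JHomW.precomp (hom C B) (homToTensor C A)
        (JHomW.postcomp (tensor C.dual A) (tensorToHom C B) (JHomW.lTensor C.dual c)) :=
  rfl

/-- `Hom(C, ·)` on classes is injective iff `1_{C^∨} ⊗ ·` is: `Hom(C, c) = 0 ↔ 1 ⊗ c = 0`.
[cite: BrylinskiZucker1998, Prop. 5.22] -/
theorem JHomW.homLeft_eq_zero_iff (c : JHomW A B) : JHomW.homLeft C c = 0 ↔ JHomW.lTensor C.dual c = 0 := by
  rw [JHomW.homLeft_apply]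
  constructor
  · intro h
    have h1 := congrArg (JHomW.precomp (hom C B) (tensorToHom C A)) h
    rw [JHomW.precomp_precomp_of_comp_eq_id _ _ (homToTensor_comp_tensorToHom C A), map_zero] at h1
    have h2 := congrArg (JHomW.postcomp (tensor C.dual A) (homToTensor C B)) h1
    rwa [JHomW.postcomp_postcomp_of_comp_eq_id _ _ (homToTensor_comp_tensorToHom C B), map_zero] at h2
  · intro h
    rw [h, map_zero, map_zero]

namespace Extension

variable (E : Extension A B VE)

/-- **The class formula `[Hom(C, E)]_W = Hom(C, [E]_W)`** in `J⁰W₀Hom(Hom(C, A), Hom(C, B))`, for ALL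
`A`, `B`, `C`. [cite: DeligneHodgeII1971, 1.1.12] [cite: Jannsen1990MixedMotives, §9 Remark 9.3 a)] -/
theorem clsW_homLeft : (E.homLeft C).clsW = JHomW.homLeft C E.clsW := by
  rw [JHomW.homLeft_apply, ← clsW_lTensor, clsW_homLeft_eq_clsW_lTensor_dual]

/-- `Hom(C, E)` splits iff `Hom(C, [E]_W) = 0`. [cite: BrylinskiZucker1998, Prop. 5.22] -/
theorem isSplit_homLeft_iff_clsW : (E.homLeft C).IsSplit ↔ JHomW.homLeft C E.clsW = 0 := by
  rw [isSplit_iff_clsW_eq_zero, clsW_homLeft]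

variable {VE' : Type*} [AddCommGroup VE'] [Module ℚ VE'] [FiniteDimensional ℚ VE']

/-- **Extensions with the same refined class have congruent `Hom(C, −)`.** [cite: BrylinskiZucker1998, Prop. 5.22] -/
theorem nonempty_congruence_homLeft_of_clsW_eq {E' : Extension A B VE'} (h : E.clsW = E'.clsW) :
    Nonempty (Congruence (E.homLeft C) (E'.homLeft C)) := by
  rw [nonempty_congruence_iff_clsW_eq, clsW_homLeft, clsW_homLeft, h]

end Extension

end HomLeft

/-! ### §2 `Hom(E, C) ≅ E^∨ ⊗ C` as extensions, and the class of `Hom(E, C)` -/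

section HomRight

variable {VE : Type*} [AddCommGroup VE] [Module ℚ VE] [FiniteDimensional ℚ VE]
variable {A : MixedHodgeStructure VA} {B : MixedHodgeStructure VB}

namespace Extension

variable (E : Extension A B VE) (C : MixedHodgeStructure VC)

/-- **The isomorphism of extensions `E^∨ ⊗ C → Hom(E, C)`** over `A^∨ ⊗ C ≅ Hom(A, C)` and
`B^∨ ⊗ C ≅ Hom(B, C)` (`E^∨ : 0 → A^∨ —ᵗπ→ E^∨ —ᵗi→ B^∨ → 0` the dual extension; components
`tensorToHom`). [cite: DeligneHodgeII1971, 1.1.12] [cite: Carlson1980, §2(c) Remark (3)] -/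
def dualRTensorToHomRight : Morphism (E.dual.rTensor C) (E.homRight C) where
  left := tensorToHom A C
  mid := tensorToHom E.mhs C
  right := tensorToHom B C
  mid_inc := by
    change (tensorToHom E.mhs C).toLinearMap ∘ₗ (E.proj.transpose.tensorMap (Hom.id C)).toLinearMap =
      (Hom.homMap E.proj (Hom.id C)).toLinearMap ∘ₗ (tensorToHom A C).toLinearMap
    rw [← Hom.comp_toLinearMap, ← Hom.comp_toLinearMap, Hom.homMap_comp_tensorToHom]
  proj_mid := by
    change (Hom.homMap E.inc (Hom.id C)).toLinearMap ∘ₗ (tensorToHom E.mhs C).toLinearMap =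
      (tensorToHom B C).toLinearMap ∘ₗ (E.inc.transpose.tensorMap (Hom.id C)).toLinearMap
    rw [← Hom.comp_toLinearMap, ← Hom.comp_toLinearMap, Hom.homMap_comp_tensorToHom]

/-- Components of `E^∨ ⊗ C → Hom(E, C)` (by `rfl`). [cite: CattaniElZeinGriffithsLe2014, §3.2.2.7] -/
@[simp]
theorem dualRTensorToHomRight_left : (E.dualRTensorToHomRight C).left = tensorToHom A C := rfl

/-- Components of `E^∨ ⊗ C → Hom(E, C)` (by `rfl`). [cite: CattaniElZeinGriffithsLe2014, §3.2.2.7] -/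
@[simp]
theorem dualRTensorToHomRight_mid : (E.dualRTensorToHomRight C).mid = tensorToHom E.mhs C := rfl

/-- Components of `E^∨ ⊗ C → Hom(E, C)` (by `rfl`). [cite: CattaniElZeinGriffithsLe2014, §3.2.2.7] -/
@[simp]
theorem dualRTensorToHomRight_right : (E.dualRTensorToHomRight C).right = tensorToHom B C := rfl

/-- **The inverse isomorphism of extensions `Hom(E, C) → E^∨ ⊗ C`** (components `homToTensor`).
[cite: DeligneHodgeII1971, 1.1.12] [cite: Carlson1980, §2(c) Remark (3)] -/
def homRightToDualRTensor : Morphism (E.homRight C) (E.dual.rTensor C) where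
  left := homToTensor A C
  mid := homToTensor E.mhs C
  right := homToTensor B C
  mid_inc := by
    change (homToTensor E.mhs C).toLinearMap ∘ₗ (Hom.homMap E.proj (Hom.id C)).toLinearMap =
      (E.proj.transpose.tensorMap (Hom.id C)).toLinearMap ∘ₗ (homToTensor A C).toLinearMap
    rw [← Hom.comp_toLinearMap, ← Hom.comp_toLinearMap, homToTensor_comp_homMap]
  proj_mid := by
    change (E.inc.transpose.tensorMap (Hom.id C)).toLinearMap ∘ₗ (homToTensor E.mhs C).toLinearMap =
      (homToTensor B C).toLinearMap ∘ₗ (Hom.homMap E.inc (Hom.id C)).toLinearMap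
    rw [← Hom.comp_toLinearMap, ← Hom.comp_toLinearMap, homToTensor_comp_homMap]

/-- Components of `Hom(E, C) → E^∨ ⊗ C` (by `rfl`). [cite: CattaniElZeinGriffithsLe2014, §3.2.2.7] -/
@[simp]
theorem homRightToDualRTensor_left : (E.homRightToDualRTensor C).left = homToTensor A C := rfl

/-- Components of `Hom(E, C) → E^∨ ⊗ C` (by `rfl`). [cite: CattaniElZeinGriffithsLe2014, §3.2.2.7] -/
@[simp]
theorem homRightToDualRTensor_mid : (E.homRightToDualRTensor C).mid = homToTensor E.mhs C := rfl

/-- Components of `Hom(E, C) → E^∨ ⊗ C` (by `rfl`). [cite: CattaniElZeinGriffithsLe2014, §3.2.2.7] -/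
@[simp]
theorem homRightToDualRTensor_right : (E.homRightToDualRTensor C).right = homToTensor B C := rfl

/-- **`(A^∨ ⊗ C ≅ Hom(A, C))_* (E^∨ ⊗ C) ≡ (B^∨ ⊗ C ≅ Hom(B, C))^* Hom(E, C)`.**
[cite: MacLane1963Homology, Ch. III Prop. 1.8] -/
theorem nonempty_congruence_dual_rTensor_pushout_homRight_pullback :
    Nonempty (Congruence ((E.dual.rTensor C).pushout (tensorToHom A C))
      ((E.homRight C).pullback (tensorToHom B C))) :=
  nonempty_congruence_pushout_pullback_of_morphism (E.dualRTensorToHomRight C)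

/-- Conversely `(Hom(A, C) ≅ A^∨ ⊗ C)_* Hom(E, C) ≡ (Hom(B, C) ≅ B^∨ ⊗ C)^* (E^∨ ⊗ C)`.
[cite: MacLane1963Homology, Ch. III Prop. 1.8] -/
theorem nonempty_congruence_homRight_pushout_dual_rTensor_pullback :
    Nonempty (Congruence ((E.homRight C).pushout (homToTensor A C))
      ((E.dual.rTensor C).pullback (homToTensor B C))) :=
  nonempty_congruence_pushout_pullback_of_morphism (E.homRightToDualRTensor C)

/-- In the complete invariant: `(≅)_* [E^∨ ⊗ C]_W = (≅)^* [Hom(E, C)]_W`. [cite: MacLane1963Homology, Ch. III Prop. 1.8] -/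
theorem postcomp_clsW_dual_rTensor_eq_precomp_clsW_homRight :
    JHomW.postcomp (tensor B.dual C) (tensorToHom A C) (E.dual.rTensor C).clsW =
      JHomW.precomp (hom A C) (tensorToHom B C) (E.homRight C).clsW :=
  (E.dualRTensorToHomRight C).postcomp_clsW_eq_precomp_clsW

/-- **`[Hom(E, C)]_W = (Hom(B, C) ≅ B^∨ ⊗ C)^* (A^∨ ⊗ C ≅ Hom(A, C))_* [E^∨ ⊗ C]_W`.**
[cite: MacLane1963Homology, Ch. III Prop. 1.8] [cite: DeligneHodgeII1971, 1.1.12] -/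
theorem clsW_homRight_eq_clsW_dual_rTensor :
    (E.homRight C).clsW =
      JHomW.precomp (hom A C) (homToTensor B C)
        (JHomW.postcomp (tensor B.dual C) (tensorToHom A C) (E.dual.rTensor C).clsW) := by
  rw [postcomp_clsW_dual_rTensor_eq_precomp_clsW_homRight,
    JHomW.precomp_precomp_of_comp_eq_id _ _ (tensorToHom_comp_homToTensor B C)]

/-- Conversely `[E^∨ ⊗ C]_W = (≅)^* (≅)_* [Hom(E, C)]_W`. [cite: MacLane1963Homology, Ch. III Prop. 1.8] -/
theorem clsW_dual_rTensor_eq_clsW_homRight :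
    (E.dual.rTensor C).clsW =
      JHomW.precomp (tensor A.dual C) (tensorToHom B C)
        (JHomW.postcomp (hom B C) (homToTensor A C) (E.homRight C).clsW) := by
  have h := (E.homRightToDualRTensor C).postcomp_clsW_eq_precomp_clsW
  rw [homRightToDualRTensor_left, homRightToDualRTensor_right] at h
  rw [h, JHomW.precomp_precomp_of_comp_eq_id _ _ (homToTensor_comp_tensorToHom B C)]

/-- **`Hom(E, C)` splits iff `E^∨ ⊗ C` splits.** [cite: MacLane1963Homology, Ch. III Prop. 1.8] -/
theorem isSplit_homRight_iff : (E.homRight C).IsSplit ↔ (E.dual.rTensor C).IsSplit := by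
  rw [isSplit_iff_clsW_eq_zero, isSplit_iff_clsW_eq_zero]
  constructor
  · intro h
    rw [clsW_dual_rTensor_eq_clsW_homRight, h, map_zero, map_zero]
  · intro h
    rw [clsW_homRight_eq_clsW_dual_rTensor, h, map_zero, map_zero]

end Extension

variable (C : MixedHodgeStructure VC)

/-- **`Hom(·, C) : J⁰W₀Hom(A, B) → J⁰W₀Hom(Hom(B, C), Hom(A, C))`**, `c ↦ -(≅)^* (≅)_* (ᵗc ⊗ 1_C)`:
the transport of `· ⊗ 1_C` on the dual class along `Hom = dual ⊗`, with Carlson's sign `[E^∨] = -ᵗ[E]`.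
[cite: Carlson1980, §2(c) Remark (3)] [cite: DeligneHodgeII1971, 1.1.12] -/
def JHomW.homRight : JHomW A B →ₗ[ℚ] JHomW (hom B C) (hom A C) :=
  -(JHomW.precomp (hom A C) (homToTensor B C) ∘ₗ JHomW.postcomp (tensor B.dual C) (tensorToHom A C) ∘ₗ
    JHomW.rTensor VC C ∘ₗ JHomW.transposeW A B)

/-- Unfolding `JHomW.homRight`. [cite: Carlson1980, §2(c) Remark (3)] -/
theorem JHomW.homRight_apply (c : JHomW A B) :
    JHomW.homRight C c =
      -JHomW.precomp (hom A C) (homToTensor B C)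
        (JHomW.postcomp (tensor B.dual C) (tensorToHom A C) (JHomW.rTensor VC C (JHomW.transposeW A B c))) :=
  rfl

/-- `JHomW.homRight C c`, the sign moved inside: `(≅)^* (≅)_* ((-ᵗc) ⊗ 1_C)`. [cite: Carlson1980, §2(c) Remark (3)] -/
theorem JHomW.homRight_apply' (c : JHomW A B) :
    JHomW.homRight C c =
      JHomW.precomp (hom A C) (homToTensor B C)
        (JHomW.postcomp (tensor B.dual C) (tensorToHom A C) (JHomW.rTensor VC C (-JHomW.transposeW A B c))) := by
  rw [JHomW.homRight_apply, map_neg, map_neg, map_neg]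

/-- `Hom(c, C) = 0 ↔ ᵗc ⊗ 1_C = 0`. [cite: BrylinskiZucker1998, Prop. 5.22] -/
theorem JHomW.homRight_eq_zero_iff (c : JHomW A B) :
    JHomW.homRight C c = 0 ↔ JHomW.rTensor VC C (JHomW.transposeW A B c) = 0 := by
  rw [JHomW.homRight_apply, neg_eq_zero]
  constructor
  · intro h
    have h1 := congrArg (JHomW.precomp (hom A C) (tensorToHom B C)) h
    rw [JHomW.precomp_precomp_of_comp_eq_id _ _ (homToTensor_comp_tensorToHom B C), map_zero] at h1
    have h2 := congrArg (JHomW.postcomp (tensor B.dual C) (homToTensor A C)) h1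
    rwa [JHomW.postcomp_postcomp_of_comp_eq_id _ _ (homToTensor_comp_tensorToHom A C), map_zero] at h2
  · intro h
    rw [h, map_zero, map_zero]

namespace Extension

variable (E : Extension A B VE)

/-- **The class formula `[Hom(E, C)]_W = Hom([E]_W, C) = -(≅)^* (≅)_* (ᵗ[E]_W ⊗ 1_C)`**, for ALL
`A`, `B`, `C`. [cite: Carlson1980, §2(c) Remark (3)] [cite: DeligneHodgeII1971, 1.1.12] -/
theorem clsW_homRight : (E.homRight C).clsW = JHomW.homRight C E.clsW := by
  rw [JHomW.homRight_apply', ← clsW_dual, ← clsW_rTensor, clsW_homRight_eq_clsW_dual_rTensor]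

/-- `Hom(E, C)` splits iff `Hom([E]_W, C) = 0`. [cite: BrylinskiZucker1998, Prop. 5.22] -/
theorem isSplit_homRight_iff_clsW : (E.homRight C).IsSplit ↔ JHomW.homRight C E.clsW = 0 := by
  rw [isSplit_iff_clsW_eq_zero, clsW_homRight]

variable {VE' : Type*} [AddCommGroup VE'] [Module ℚ VE'] [FiniteDimensional ℚ VE']

/-- **Extensions with the same refined class have congruent `Hom(−, C)`.** [cite: BrylinskiZucker1998, Prop. 5.22] -/
theorem nonempty_congruence_homRight_of_clsW_eq {E' : Extension A B VE'} (h : E.clsW = E'.clsW) :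
    Nonempty (Congruence (E.homRight C) (E'.homRight C)) := by
  rw [nonempty_congruence_iff_clsW_eq, clsW_homRight, clsW_homRight, h]

end Extension

end HomRight

/-! ### §3 `Hom(C, −)` and `Hom(−, C)` on `Ext`: transport formulas and additivity -/

namespace Ext

variable {A : MixedHodgeStructure VA} {B : MixedHodgeStructure VB} (C : MixedHodgeStructure VC)

/-- **`(C^∨ ⊗ B ≅ Hom(C, B))_* (C^∨ ⊗ x) = (C^∨ ⊗ A ≅ Hom(C, A))^* Hom(C, x)`** on `Ext`.
[cite: MacLane1963Homology, Ch. III Prop. 1.8] [cite: DeligneHodgeII1971, 1.1.12] -/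
theorem pushoutMapW_tensorToHom_lTensorMap_dual (x : Ext A B) :
    pushoutMapW (tensorToHom C B) (lTensorMap C.dual x) = pullbackMapW (tensorToHom C A) (homLeftMap C x) := by
  obtain ⟨E, rfl⟩ := exists_mkOfW_eq x
  rw [lTensorMap_mkOfW, homLeftMap_mkOfW]
  exact pushoutMapW_mkOfW_eq_pullbackMapW_mkOfW (E.lTensorDualToHomLeft C)

/-- **`Hom(C, x) = (Hom(C, A) ≅ C^∨ ⊗ A)^* (C^∨ ⊗ B ≅ Hom(C, B))_* (C^∨ ⊗ x)`**: `Ext.homLeftMap` is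
`Ext.lTensorMap C^∨` transported along `Hom = dual ⊗`. [cite: DeligneHodgeII1971, 1.1.12] -/
theorem homLeftMap_eq (x : Ext A B) :
    homLeftMap C x =
      pullbackMapW (homToTensor C A) (pushoutMapW (tensorToHom C B) (lTensorMap C.dual x)) := by
  rw [pushoutMapW_tensorToHom_lTensorMap_dual,
    pullbackMapW_pullbackMapW_of_comp_eq_id _ _ (tensorToHom_comp_homToTensor C A)]

/-- Conversely `C^∨ ⊗ x = (≅)^* (≅)_* Hom(C, x)`. [cite: DeligneHodgeII1971, 1.1.12] -/
theorem lTensorMap_dual_eq (x : Ext A B) :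
    lTensorMap C.dual x =
      pullbackMapW (tensorToHom C A) (pushoutMapW (homToTensor C B) (homLeftMap C x)) := by
  obtain ⟨E, rfl⟩ := exists_mkOfW_eq x
  have h := pushoutMapW_mkOfW_eq_pullbackMapW_mkOfW (E.homLeftToLTensorDual C)
  rw [Extension.homLeftToLTensorDual_left, Extension.homLeftToLTensorDual_right] at h
  rw [lTensorMap_mkOfW, homLeftMap_mkOfW, h,
    pullbackMapW_pullbackMapW_of_comp_eq_id _ _ (homToTensor_comp_tensorToHom C A)]

/-- **`extEquivJHomW (Hom(C, x)) = Hom(C, extEquivJHomW x)`**: `Hom(C, −)` on `Ext` is `JHomW.homLeft C`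
under Brylinski–Zucker's bijection. [cite: BrylinskiZucker1998, Prop. 5.22] -/
@[simp]
theorem extEquivJHomW_homLeftMap (x : Ext A B) :
    extEquivJHomW (homLeftMap C x) = JHomW.homLeft C (extEquivJHomW x) := by
  rw [homLeftMap_eq, extEquivJHomW_pullbackMapW, ← extEquivJHomW_apply, extEquivJHomW_pushoutMapW,
    ← extEquivJHomW_apply, extEquivJHomW_lTensorMap, JHomW.homLeft_apply]

/-- `clsW (Hom(C, x)) = Hom(C, clsW x)`. [cite: BrylinskiZucker1998, Prop. 5.22] -/
theorem clsW_homLeftMap (x : Ext A B) : clsW (homLeftMap C x) = JHomW.homLeft C (clsW x) :=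
  extEquivJHomW_homLeftMap C x

/-- **`Hom(C, −) : Ext(A, B) → Ext(Hom(C, A), Hom(C, B))` is additive** for the Baer sum.
[cite: MacLane1963Homology, Ch. III Thm. 2.1] -/
theorem homLeftMap_addW (x y : Ext A B) :
    homLeftMap C (addW x y) = addW (homLeftMap C x) (homLeftMap C y) :=
  extEquivJHomW.injective (by
    rw [extEquivJHomW_homLeftMap, extEquivJHomW_addW, extEquivJHomW_addW, map_add,
      extEquivJHomW_homLeftMap, extEquivJHomW_homLeftMap])

/-- `Hom(C, -x) = -Hom(C, x)`. [cite: MacLane1963Homology, Ch. III Thm. 2.1] -/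
theorem homLeftMap_negW (x : Ext A B) : homLeftMap C (negW x) = negW (homLeftMap C x) :=
  extEquivJHomW.injective (by
    rw [extEquivJHomW_homLeftMap, extEquivJHomW_negW, extEquivJHomW_negW, map_neg, extEquivJHomW_homLeftMap])

/-- `Hom(C, x - y) = Hom(C, x) - Hom(C, y)`. [cite: MacLane1963Homology, Ch. III Thm. 2.1] -/
theorem homLeftMap_addW_negW (x y : Ext A B) :
    homLeftMap C (addW x (negW y)) = addW (homLeftMap C x) (negW (homLeftMap C y)) := by
  rw [homLeftMap_addW, homLeftMap_negW]

/-- **`Hom(C, x)` splits iff `C^∨ ⊗ x` splits.** [cite: MacLane1963Homology, Ch. III Prop. 1.8] -/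
theorem homLeftMap_eq_zeroW_iff (x : Ext A B) : homLeftMap C x = zeroW ↔ lTensorMap C.dual x = zeroW := by
  obtain ⟨E, rfl⟩ := exists_mkOfW_eq x
  rw [homLeftMap_mkOfW, lTensorMap_mkOfW, mkOfW_eq_zeroW_iff, mkOfW_eq_zeroW_iff, Extension.isSplit_homLeft_iff]

/-- `Hom(C, x)` splits iff `Hom(C, clsW x) = 0`. [cite: BrylinskiZucker1998, Prop. 5.22] -/
theorem homLeftMap_eq_zeroW_iff_clsW (x : Ext A B) :
    homLeftMap C x = zeroW ↔ JHomW.homLeft C (clsW x) = 0 := by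
  rw [← extEquivJHomW.injective.eq_iff, extEquivJHomW_homLeftMap, extEquivJHomW_zeroW, extEquivJHomW_apply]

/-- **`(A^∨ ⊗ C ≅ Hom(A, C))_* (x^∨ ⊗ C) = (B^∨ ⊗ C ≅ Hom(B, C))^* Hom(x, C)`** on `Ext`
(`x^∨ = Ext.dualEquivW x`). [cite: MacLane1963Homology, Ch. III Prop. 1.8] [cite: Carlson1980, §2(c) Remark (3)] -/
theorem pushoutMapW_tensorToHom_rTensorMap_dualEquivW (x : Ext A B) :
    pushoutMapW (tensorToHom A C) (rTensorMap C (dualEquivW x)) =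
      pullbackMapW (tensorToHom B C) (homRightMap C x) := by
  obtain ⟨E, rfl⟩ := exists_mkOfW_eq x
  rw [dualEquivW_mkOfW, rTensorMap_mkOfW, homRightMap_mkOfW]
  exact pushoutMapW_mkOfW_eq_pullbackMapW_mkOfW (E.dualRTensorToHomRight C)

/-- **`Hom(x, C) = (Hom(B, C) ≅ B^∨ ⊗ C)^* (A^∨ ⊗ C ≅ Hom(A, C))_* (x^∨ ⊗ C)`**: `Ext.homRightMap` is
`Ext.rTensorMap C ∘ Ext.dualEquivW` transported along `Hom = dual ⊗`. [cite: Carlson1980, §2(c) Remark (3)] -/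
theorem homRightMap_eq (x : Ext A B) :
    homRightMap C x =
      pullbackMapW (homToTensor B C) (pushoutMapW (tensorToHom A C) (rTensorMap C (dualEquivW x))) := by
  rw [pushoutMapW_tensorToHom_rTensorMap_dualEquivW,
    pullbackMapW_pullbackMapW_of_comp_eq_id _ _ (tensorToHom_comp_homToTensor B C)]

/-- Conversely `x^∨ ⊗ C = (≅)^* (≅)_* Hom(x, C)`. [cite: Carlson1980, §2(c) Remark (3)] -/
theorem rTensorMap_dualEquivW_eq (x : Ext A B) :
    rTensorMap C (dualEquivW x) =
      pullbackMapW (tensorToHom B C) (pushoutMapW (homToTensor A C) (homRightMap C x)) := by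
  obtain ⟨E, rfl⟩ := exists_mkOfW_eq x
  have h := pushoutMapW_mkOfW_eq_pullbackMapW_mkOfW (E.homRightToDualRTensor C)
  rw [Extension.homRightToDualRTensor_left, Extension.homRightToDualRTensor_right] at h
  rw [dualEquivW_mkOfW, rTensorMap_mkOfW, homRightMap_mkOfW, h,
    pullbackMapW_pullbackMapW_of_comp_eq_id _ _ (homToTensor_comp_tensorToHom B C)]

/-- **`extEquivJHomW (Hom(x, C)) = Hom(extEquivJHomW x, C)`**: `Hom(−, C)` on `Ext` is
`JHomW.homRight C` under Brylinski–Zucker's bijection. [cite: BrylinskiZucker1998, Prop. 5.22] -/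
@[simp]
theorem extEquivJHomW_homRightMap (x : Ext A B) :
    extEquivJHomW (homRightMap C x) = JHomW.homRight C (extEquivJHomW x) := by
  rw [homRightMap_eq, extEquivJHomW_pullbackMapW, ← extEquivJHomW_apply, extEquivJHomW_pushoutMapW,
    ← extEquivJHomW_apply, extEquivJHomW_rTensorMap, extEquivJHomW_apply (dualEquivW x), clsW_dualEquivW,
    JHomW.homRight_apply', extEquivJHomW_apply]

/-- `clsW (Hom(x, C)) = Hom(clsW x, C)`. [cite: BrylinskiZucker1998, Prop. 5.22] -/
theorem clsW_homRightMap (x : Ext A B) : clsW (homRightMap C x) = JHomW.homRight C (clsW x) :=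
  extEquivJHomW_homRightMap C x

/-- **`Hom(−, C) : Ext(A, B) → Ext(Hom(B, C), Hom(A, C))` is additive** for the Baer sum.
[cite: MacLane1963Homology, Ch. III Thm. 2.1] -/
theorem homRightMap_addW (x y : Ext A B) :
    homRightMap C (addW x y) = addW (homRightMap C x) (homRightMap C y) :=
  extEquivJHomW.injective (by
    rw [extEquivJHomW_homRightMap, extEquivJHomW_addW, extEquivJHomW_addW, map_add,
      extEquivJHomW_homRightMap, extEquivJHomW_homRightMap])

/-- `Hom(-x, C) = -Hom(x, C)`. [cite: MacLane1963Homology, Ch. III Thm. 2.1] -/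
theorem homRightMap_negW (x : Ext A B) : homRightMap C (negW x) = negW (homRightMap C x) :=
  extEquivJHomW.injective (by
    rw [extEquivJHomW_homRightMap, extEquivJHomW_negW, extEquivJHomW_negW, map_neg, extEquivJHomW_homRightMap])

/-- `Hom(x - y, C) = Hom(x, C) - Hom(y, C)`. [cite: MacLane1963Homology, Ch. III Thm. 2.1] -/
theorem homRightMap_addW_negW (x y : Ext A B) :
    homRightMap C (addW x (negW y)) = addW (homRightMap C x) (negW (homRightMap C y)) := by
  rw [homRightMap_addW, homRightMap_negW]

/-- **`Hom(x, C)` splits iff `x^∨ ⊗ C` splits.** [cite: MacLane1963Homology, Ch. III Prop. 1.8] -/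
theorem homRightMap_eq_zeroW_iff (x : Ext A B) :
    homRightMap C x = zeroW ↔ rTensorMap C (dualEquivW x) = zeroW := by
  obtain ⟨E, rfl⟩ := exists_mkOfW_eq x
  rw [homRightMap_mkOfW, dualEquivW_mkOfW, rTensorMap_mkOfW, mkOfW_eq_zeroW_iff, mkOfW_eq_zeroW_iff,
    Extension.isSplit_homRight_iff]

/-- `Hom(x, C)` splits iff `Hom(clsW x, C) = 0`. [cite: BrylinskiZucker1998, Prop. 5.22] -/
theorem homRightMap_eq_zeroW_iff_clsW (x : Ext A B) :
    homRightMap C x = zeroW ↔ JHomW.homRight C (clsW x) = 0 := by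
  rw [← extEquivJHomW.injective.eq_iff, extEquivJHomW_homRightMap, extEquivJHomW_zeroW, extEquivJHomW_apply]

end Ext

/-! ### §4 Carlson's dual extension: `Hom(E, ℚ(0)) ≅ E^∨` -/

section Unit

variable {V : Type*} [AddCommGroup V] [Module ℚ V] [FiniteDimensional ℚ V] (X : MixedHodgeStructure V)

omit [FiniteDimensional ℚ V] in
/-- `lid ∘ σ = dualTensorHom` on `V^∨ ⊗ ℚ`: `q • ψ = (v ↦ ψ(v) q)`. [folklore] -/
private theorem lid_comm_eq_dualTensorHom (t : Module.Dual ℚ V ⊗[ℚ] ℚ) :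
    TensorProduct.lid ℚ (Module.Dual ℚ V) (TensorProduct.comm ℚ (Module.Dual ℚ V) ℚ t) =
      dualTensorHom ℚ V ℚ t := by
  induction t using TensorProduct.induction_on with
  | zero => simp only [map_zero]
  | add x y hx hy => simp only [map_add, hx, hy]
  | tmul ψ q =>
    rw [TensorProduct.comm_tmul, TensorProduct.lid_tmul]
    refine LinearMap.ext fun v => ?_
    rw [LinearMap.smul_apply, dualTensorHom_apply, smul_eq_mul, smul_eq_mul, mul_comm]

/-- `dualTensorHomEquiv = dualTensorHom` pointwise. [folklore] -/
private theorem dualTensorHomEquiv_apply' (t : Module.Dual ℚ V ⊗[ℚ] ℚ) :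
    dualTensorHomEquiv ℚ V ℚ t = dualTensorHom ℚ V ℚ t := by
  rw [dualTensorHomEquiv, dualTensorHomEquivOfBasis_apply]

/-- **The isomorphism of MHS `Hom(X, ℚ(0)) → X^∨`** — the composite
`Hom(X, ℚ(0)) ≅ X^∨ ⊗ ℚ(0) ≅ ℚ(0) ⊗ X^∨ ≅ X^∨` (`homToTensor`, symmetry, unit); its underlying map is
the identity of `V →ₗ ℚ` (`homUnitToDual_toLinearMap_apply`). Carlson's `^ = Hom(−, ℚ(0))`.
[cite: Carlson1980, §2(c) Remark (3)] [cite: DeligneHodgeII1971, 1.1.12] -/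
def homUnitToDual : Hom (hom X (tate 0).toMixedHodgeStructure) X.dual :=
  ((unitTensorHom X.dual).comp (tensorComm X.dual (tate 0).toMixedHodgeStructure)).comp
    (homToTensor X (tate 0).toMixedHodgeStructure)

/-- **`Hom(X, ℚ(0)) → X^∨` is the identity on underlying maps `V →ₗ ℚ`.** [cite: Carlson1980, §2(c) Remark (3)] -/
@[simp]
theorem homUnitToDual_toLinearMap_apply (φ : V →ₗ[ℚ] ℚ) : (homUnitToDual X).toLinearMap φ = φ := by
  rw [homUnitToDual, Hom.comp_toLinearMap, Hom.comp_toLinearMap, LinearMap.comp_apply, LinearMap.comp_apply,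
    homToTensor_toLinearMap, tensorComm_toLinearMap, unitTensorHom_toLinearMap, LinearEquiv.coe_coe,
    LinearEquiv.coe_coe, LinearEquiv.coe_coe, lid_comm_eq_dualTensorHom, ← dualTensorHomEquiv_apply',
    LinearEquiv.apply_symm_apply]

/-- **The inverse isomorphism `X^∨ → Hom(X, ℚ(0))`** (`unit⁻¹`, symmetry, `tensorToHom`).
[cite: Carlson1980, §2(c) Remark (3)] [cite: DeligneHodgeII1971, 1.1.12] -/
def dualToHomUnit : Hom X.dual (hom X (tate 0).toMixedHodgeStructure) :=
  (tensorToHom X (tate 0).toMixedHodgeStructure).comp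
    ((tensorComm (tate 0).toMixedHodgeStructure X.dual).comp (unitTensorInv X.dual))

/-- `X^∨ → Hom(X, ℚ(0))` is the identity on underlying maps. [cite: Carlson1980, §2(c) Remark (3)] -/
@[simp]
theorem dualToHomUnit_toLinearMap_apply (φ : Module.Dual ℚ V) : (dualToHomUnit X).toLinearMap φ = φ := by
  rw [dualToHomUnit, Hom.comp_toLinearMap, Hom.comp_toLinearMap, LinearMap.comp_apply, LinearMap.comp_apply,
    unitTensorInv_toLinearMap, tensorComm_toLinearMap, LinearEquiv.coe_coe, LinearEquiv.coe_coe,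
    TensorProduct.lid_symm_apply, TensorProduct.comm_tmul]
  refine LinearMap.ext fun v => ?_
  rw [tensorToHom_apply_tmul, smul_eq_mul, mul_one]

/-- `(Hom(X, ℚ(0)) → X^∨) ∘ (X^∨ → Hom(X, ℚ(0))) = id`. [cite: Carlson1980, §2(c) Remark (3)] -/
theorem homUnitToDual_comp_dualToHomUnit : (homUnitToDual X).comp (dualToHomUnit X) = Hom.id X.dual :=
  Hom.ext (LinearMap.ext fun φ => by
    rw [Hom.comp_toLinearMap, LinearMap.comp_apply, dualToHomUnit_toLinearMap_apply,
      homUnitToDual_toLinearMap_apply, Hom.id_toLinearMap, LinearMap.id_apply])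

/-- `(X^∨ → Hom(X, ℚ(0))) ∘ (Hom(X, ℚ(0)) → X^∨) = id`. [cite: Carlson1980, §2(c) Remark (3)] -/
theorem dualToHomUnit_comp_homUnitToDual :
    (dualToHomUnit X).comp (homUnitToDual X) = Hom.id (hom X (tate 0).toMixedHodgeStructure) :=
  Hom.ext (LinearMap.ext fun φ => by
    rw [Hom.comp_toLinearMap, LinearMap.comp_apply, homUnitToDual_toLinearMap_apply,
      dualToHomUnit_toLinearMap_apply, Hom.id_toLinearMap, LinearMap.id_apply])

/-- `Hom(X, ℚ(0)) → X^∨` is bijective. [cite: Carlson1980, §2(c) Remark (3)] -/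
theorem homUnitToDual_bijective : Function.Bijective (homUnitToDual X).toLinearMap := by
  refine ⟨fun φ ψ h => ?_, fun φ => ⟨φ, homUnitToDual_toLinearMap_apply X φ⟩⟩
  rwa [homUnitToDual_toLinearMap_apply, homUnitToDual_toLinearMap_apply] at h

/-- `X^∨ → Hom(X, ℚ(0))` is bijective. [cite: Carlson1980, §2(c) Remark (3)] -/
theorem dualToHomUnit_bijective : Function.Bijective (dualToHomUnit X).toLinearMap := by
  refine ⟨fun φ ψ h => ?_, fun φ => ⟨φ, dualToHomUnit_toLinearMap_apply X φ⟩⟩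
  rwa [dualToHomUnit_toLinearMap_apply, dualToHomUnit_toLinearMap_apply] at h

end Unit

section CarlsonDual

variable {VE : Type*} [AddCommGroup VE] [Module ℚ VE] [FiniteDimensional ℚ VE]
variable {A : MixedHodgeStructure VA} {B : MixedHodgeStructure VB}

namespace Extension

variable (E : Extension A B VE)

/-- **The isomorphism of extensions `Hom(E, ℚ(0)) → E^∨`** over `Hom(A, ℚ(0)) ≅ A^∨`,
`Hom(B, ℚ(0)) ≅ B^∨`: Carlson's dual extension `0 → Â → Ĥ → B̂ → 0` IS the tree's `Extension.dual`
(composite of `Hom(E, ℚ(0)) → E^∨ ⊗ ℚ(0)` and `E^∨ ⊗ ℚ(0) → E^∨`). [cite: Carlson1980, §2(c) Remark (3)] -/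
def homRightUnitToDual : Morphism (E.homRight (tate 0).toMixedHodgeStructure) E.dual :=
  E.dual.rTensorUnitToSelf.comp (E.homRightToDualRTensor (tate 0).toMixedHodgeStructure)

/-- The sub component of `Hom(E, ℚ(0)) → E^∨` is `Hom(A, ℚ(0)) ≅ A^∨` (by `rfl`). [cite: Carlson1980, §2(c) Remark (3)] -/
@[simp]
theorem homRightUnitToDual_left : E.homRightUnitToDual.left = homUnitToDual A := rfl

/-- The quotient component of `Hom(E, ℚ(0)) → E^∨` is `Hom(B, ℚ(0)) ≅ B^∨` (by `rfl`). [cite: Carlson1980, §2(c) Remark (3)] -/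
@[simp]
theorem homRightUnitToDual_right : E.homRightUnitToDual.right = homUnitToDual B := rfl

/-- The middle component of `Hom(E, ℚ(0)) → E^∨` is `Hom(E, ℚ(0)) ≅ E^∨` (by `rfl`). [cite: Carlson1980, §2(c) Remark (3)] -/
theorem homRightUnitToDual_mid : E.homRightUnitToDual.mid = homUnitToDual E.mhs := rfl

/-- On underlying maps `Hom(E, ℚ(0)) → E^∨` is the identity of `VE →ₗ ℚ`. [cite: Carlson1980, §2(c) Remark (3)] -/
theorem homRightUnitToDual_mid_toLinearMap_apply (φ : VE →ₗ[ℚ] ℚ) :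
    E.homRightUnitToDual.mid.toLinearMap φ = φ := by
  rw [homRightUnitToDual_mid, homUnitToDual_toLinearMap_apply]

/-- **`(Hom(A, ℚ(0)) ≅ A^∨)_* Hom(E, ℚ(0)) ≡ (Hom(B, ℚ(0)) ≅ B^∨)^* E^∨`.** [cite: Carlson1980, §2(c) Remark (3)]
[cite: MacLane1963Homology, Ch. III Prop. 1.8] -/
theorem nonempty_congruence_homRight_unit_pushout_dual_pullback :
    Nonempty (Congruence ((E.homRight (tate 0).toMixedHodgeStructure).pushout (homUnitToDual A))
      (E.dual.pullback (homUnitToDual B))) :=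
  nonempty_congruence_pushout_pullback_of_morphism E.homRightUnitToDual

/-- **`Hom(E, ℚ(0))` splits iff `E` splits.** [cite: Carlson1980, §2(c) Remark (3)] -/
theorem isSplit_homRight_unit_iff : (E.homRight (tate 0).toMixedHodgeStructure).IsSplit ↔ E.IsSplit := by
  rw [isSplit_homRight_iff, isSplit_rTensor_tate_iff, isSplit_dual_iff]

end Extension

namespace Ext

/-- **`(Hom(A, ℚ(0)) ≅ A^∨)_* Hom(x, ℚ(0)) = (Hom(B, ℚ(0)) ≅ B^∨)^* x^∨`** on `Ext`: Carlson's dual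
extension class is `Ext.dualEquivW` up to the canonical isomorphisms. [cite: Carlson1980, §2(c) Remark (3)] -/
theorem pushoutMapW_homUnitToDual_homRightMap (x : Ext A B) :
    pushoutMapW (homUnitToDual A) (homRightMap (tate 0).toMixedHodgeStructure x) =
      pullbackMapW (homUnitToDual B) (dualEquivW x) := by
  obtain ⟨E, rfl⟩ := exists_mkOfW_eq x
  rw [homRightMap_mkOfW, dualEquivW_mkOfW]
  exact pushoutMapW_mkOfW_eq_pullbackMapW_mkOfW E.homRightUnitToDual

/-- **`x^∨ = (B^∨ ≅ Hom(B, ℚ(0)))^* (Hom(A, ℚ(0)) ≅ A^∨)_* Hom(x, ℚ(0))`.** [cite: Carlson1980, §2(c) Remark (3)] -/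
theorem dualEquivW_eq_homRightMap_unit (x : Ext A B) :
    dualEquivW x =
      pullbackMapW (dualToHomUnit B)
        (pushoutMapW (homUnitToDual A) (homRightMap (tate 0).toMixedHodgeStructure x)) := by
  rw [pushoutMapW_homUnitToDual_homRightMap,
    pullbackMapW_pullbackMapW_of_comp_eq_id _ _ (homUnitToDual_comp_dualToHomUnit B)]

/-- **`Hom(x, ℚ(0)) = (A^∨ ≅ Hom(A, ℚ(0)))_* (Hom(B, ℚ(0)) ≅ B^∨)^* x^∨`.** [cite: Carlson1980, §2(c) Remark (3)] -/
theorem homRightMap_unit_eq_dualEquivW (x : Ext A B) :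
    homRightMap (tate 0).toMixedHodgeStructure x =
      pushoutMapW (dualToHomUnit A) (pullbackMapW (homUnitToDual B) (dualEquivW x)) := by
  rw [← pushoutMapW_homUnitToDual_homRightMap,
    pushoutMapW_pushoutMapW_of_comp_eq_id _ _ (dualToHomUnit_comp_homUnitToDual A)]

/-- `Hom(x, ℚ(0))` splits iff `x` splits. [cite: Carlson1980, §2(c) Remark (3)] -/
theorem homRightMap_unit_eq_zeroW_iff (x : Ext A B) :
    homRightMap (tate 0).toMixedHodgeStructure x = zeroW ↔ x = zeroW := by
  obtain ⟨E, rfl⟩ := exists_mkOfW_eq x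
  rw [homRightMap_mkOfW, mkOfW_eq_zeroW_iff, mkOfW_eq_zeroW_iff, Extension.isSplit_homRight_unit_iff]

end Ext

end CarlsonDual

end MixedHodgeStructure

end Literature.AlgebraicGeometry.Motives

end
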